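import Summits.QuantumFields.YangMills.Theorems.BalabanUVNodesN15KingModelPotentialDressedDecay

/-!
# BalabanUVNodes ∕ N15 — THE KING MODEL, PART 13a: THE DRESSED FLUCTUATION PROPAGATOR `G_w = N^{d+1}(A₀ + diag w)⁻¹` IN THE ROW-UNIFORM
# RIEMANN-SUM NORM — its resolvent fixed point `G_w = G − N^{−(d+1)}·G·diag(w)·G_w`, its uniform (weighted) Riemann MASS in the window
# `C·sup|w| ≤ 1∕2`, and its Riemann-sum TWO-SPACING RATE: the scalar model's NONPERTURBATIVE versions of [B9]'s regularity slots (3.35)–(3.36)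
# for a background-dependent propagator (Track A, DAG node N15 = NE2; FAN-OUT v1.1 §N15 s3 «KING-MODEL RUNG … what the curved case adds»)

HONEST FRAMING.  Count-neutral kernel bookkeeping (cell `pub-ymgap`, seat `pub-ymgap-dag-n15-d` g8; `--supports stmt-QuantumFields-20292
--as helper` = K3⁗ `SpineGivenEndpointR13Sep`; lineage K3 19676 → K3′ 19908 → K3‴ 19912).  King's `A = 0` SCALAR model ([King1986] §2.2 (2.13)
p. 653, (4.44) p. 675): the fluctuation propagator of the block-spin Gaussian WITH A POTENTIAL `w` added to the fine action (a multiplication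
operator — NOT Bałaban's covariant `G_k(U)` of [B9] Thm 3.14, whose background is a gauge field; [B9] prints analyticity in `U` (Thm 3.4) and
η-uniformity, never an η-difference).  NOT a node discharge; nothing continuum ∕ ℝ⁴ ∕ OS ∕ mass-gap ∕ Clay.  0 `sorry`, 1 `def` (`dressedProp`),
standard axioms.
THE POINT.  NE2's typed slots `Reg335 ∕ Reg336` ([B9] (3.35)–(3.36)) are regularity letters of a BACKGROUND-DEPENDENT PROPAGATOR.  Parts 10–11
controlled King's dressed MINIMISER and effective Laplacian; THIS FILE treats the dressed fluctuation PROPAGATOR itself, in the norm in which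
everything downstream consumes it (parts 10a∕11a):
* §1 def **`dressedProp`** `G_w := N^{d+1}·(A₀ + diag w)⁻¹`; `dressedProp_zero` (`= constrainedProp`); ★ **`dressedProp_fixedPoint`** —
  `G_w(x, y) = G(x, y) − N^{−(d+1)}Σ_z G(x, z)w(z)G_w(z, y)` (second resolvent identity, part 10b `fineOpPot_inv_eq`);
* §2 ★★ **`dressedProp_riemannMass_le`** — `Σ_y N^{−(d+1)}|G_w(x, y)| ≤ 2C_M` whenever the undressed Riemann mass is `≤ C_M`, `|w| ≤ w₀`,
  `C_M·w₀ ≤ 1∕2` (ℓ^∞-operator Neumann: the row sums are a fixed point of an affine contraction); ★★ **`dressedProp_riemannMassW_le`** — the same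
  with the exponential weight `e^{δ′|B x − B y|}` (triangle inequality through the middle point `B z`): `≤ 2C_W`;
* §3 ★★ **`dressedProp_riemannRate_le`** — THE RIEMANN-SUM TWO-SPACING RATE OF THE DRESSED PROPAGATOR: for the runs `L^k`, `L·L^k` with potentials
  `w, w′` (sizes `≤ w₀`, coherence `|w′(z′) − w(z)| ≤ ν`), `Σ_{y′} N′^{−(d+1)}|G′_{w′}(x′, y′) − G_w(x, y)| ≤ 2(R + 2RC_Mw₀ + 2C_M²ν)` where `R` bounds
  the undressed Riemann rate (part 10a) and `C_M` the undressed mass — every quantity a ROW-UNIFORM RIEMANN SUM, no pointwise control of `G`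
  near the diagonal.
All letters are numerical hypotheses; part 13b discharges them along King's run (10a∕11a constants, the window of 9a∕9c) and states the two
slots for `G_{k,v}` uniformly in `k`, the volume and the potential.
HONEST SCOPE.  (i) any unit torus and fine count in §1–§2; §3 in the two-run format `L^k`, `L·L^k`; (ii) Riemann-sum (ℓ^∞-operator) statements,
not pointwise kernel bounds (the dressed propagator is as singular on the diagonal as the undressed one); (iii) scalar potential, `A = 0`;
(iv) elementary consequences of the second resolvent identity; not a printed proposition; not a discharge.
Locators: [King1986] C. King, CMP **102** (1986) 649–677: (2.13) p. 653, Prop. 3.8 (3.71) p. 664 and p. 664 (pairing), (4.44) p. 675; [B9] =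
[Balaban1985BackgroundPropagators] CMP **99** (1985): (3.35)–(3.36) p. 396 (the two regularity slots of `G_k(U)`: typing template), Thm 3.4 p. 400.
-/

noncomputable section

open scoped BigOperators Matrix
open Finset

namespace Summit.QuantumFields.YangMills.BalabanUVNodes.N15.KingModel

open Literature.MathematicalPhysics.QuantumFieldTheory.Balaban1983to89 hiding blockOf
open Literature.MathematicalPhysics.QuantumFieldTheory.Balaban1983to89.B4Sect5Proof (latticeConst latticeConst_nonneg)
open Literature.MathematicalPhysics.QuantumFieldTheory.Balaban1983to89.B5Prop11Plancherel (Tor fine)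
open Literature.MathematicalPhysics.QuantumFieldTheory.King1986 (aK aK_pos inv_sub_inv_of_isUnit)
open Literature.MathematicalPhysics.QuantumFieldTheory.King1986.Torus
open Summit.QuantumFields.YangMills.BalabanUVNodes.N15KingModelRung.Curved (underPtN val_underPtN blockOf_underPtN)

variable {d : ℕ}

/-! ## §1 The dressed propagator and its resolvent fixed point -/

section Objects

variable (Nf : ℕ) [NeZero Nf] (U : Fin (d + 1) → ℕ) [∀ μ, NeZero (U μ)] (a m2 : ℝ)

/-- **THE DRESSED FLUCTUATION PROPAGATOR** `G_w := N^{d+1}·(A₀ + diag w)⁻¹` on the fine torus — King's `G^η = N^{d+1}A₀⁻¹` (`constrainedProp`, (2.13) ∕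
(4.44)) with the potential `w` added to the fine action (`c` is the Laplacian coefficient, `N²` for King). [cite: King1986, (2.13) p.653, (4.44) p.675] -/
def dressedProp (c : ℝ) (w : Tor (fine Nf U) → ℝ) : Matrix (Tor (fine Nf U)) (Tor (fine Nf U)) ℝ :=
  (((Nf : ℕ) : ℝ) ^ (d + 1)) • (fineOpPot Nf U a c m2 w)⁻¹

variable {Nf U a m2}

/-- At the zero potential the dressed propagator is King's `G^η`. [cite: King1986, (2.13) p.653] -/
theorem dressedProp_zero (c : ℝ) : dressedProp Nf U a m2 c 0 = constrainedProp Nf U a c m2 := by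
  rw [dressedProp, constrainedProp, fineOpPot_zero']

/-- Entries of `(A₀ + diag w)⁻¹` are `N^{−(d+1)}` times the dressed propagator. [folklore] -/
theorem fineOpPot_inv_apply_eq (c : ℝ) (w : Tor (fine Nf U) → ℝ) (x y : Tor (fine Nf U)) :
    (fineOpPot Nf U a c m2 w)⁻¹ x y = (((Nf : ℕ) : ℝ) ^ (d + 1))⁻¹ * dressedProp Nf U a m2 c w x y := by
  have hN : ((Nf : ℕ) : ℝ) ^ (d + 1) ≠ 0 := pow_ne_zero _ (Nat.cast_ne_zero.mpr (NeZero.ne Nf))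
  rw [dressedProp, Matrix.smul_apply, smul_eq_mul, ← mul_assoc, inv_mul_cancel₀ hN, one_mul]

/-- **THE DRESSED PROPAGATOR IS A RESOLVENT FIXED POINT**: `G_w(x, y) = G(x, y) − N^{−(d+1)}·Σ_z G(x, z)·w(z)·G_w(z, y)` whenever `A₀` and `A₀ + diag w` are
invertible (second resolvent identity, part 10b `fineOpPot_inv_eq`). [cite: King1986, (2.13) p.653] -/
theorem dressedProp_fixedPoint {c : ℝ} {w : Tor (fine Nf U) → ℝ} (hA : IsUnit (fineOp Nf U a c m2)) (hB : IsUnit (fineOpPot Nf U a c m2 w))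
    (x y : Tor (fine Nf U)) :
    dressedProp Nf U a m2 c w x y = constrainedProp Nf U a c m2 x y
      - (((Nf : ℕ) : ℝ) ^ (d + 1))⁻¹ * ∑ z, constrainedProp Nf U a c m2 x z * w z * dressedProp Nf U a m2 c w z y := by
  have hres := fineOpPot_inv_eq (a := a) (m2 := m2) hA hB
  have hN : ((Nf : ℕ) : ℝ) ^ (d + 1) ≠ 0 := pow_ne_zero _ (Nat.cast_ne_zero.mpr (NeZero.ne Nf))
  have hL : dressedProp Nf U a m2 c w x y = (((Nf : ℕ) : ℝ) ^ (d + 1)) * (fineOpPot Nf U a c m2 w)⁻¹ x y := by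
    rw [dressedProp, Matrix.smul_apply, smul_eq_mul]
  rw [hL, hres, Matrix.sub_apply, mul_sub]
  congr 1
  rw [Matrix.mul_apply, mul_sum, mul_sum]
  refine sum_congr rfl fun z _ => ?_
  rw [Matrix.mul_apply]
  have hdiag : (∑ j, (fineOp Nf U a c m2)⁻¹ x j * Matrix.diagonal w j z) = (fineOp Nf U a c m2)⁻¹ x z * w z := by
    rw [Finset.sum_eq_single z]
    · rw [Matrix.diagonal_apply_eq]
    · intro j _ hj
      rw [Matrix.diagonal_apply_ne _ hj, mul_zero]
    · intro h; exact absurd (Finset.mem_univ _) h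
  rw [hdiag, fineOp_inv_apply_eq, fineOpPot_inv_apply_eq]
  field_simp

end Objects

/-! ## §2 The uniform Riemann mass of the dressed propagator, plain and weighted -/

section Mass

variable {Nf : ℕ} [NeZero Nf] {U : Fin (d + 1) → ℕ} [∀ μ, NeZero (U μ)] {a m2 : ℝ}

/-- Exchange of a double sum with a factorised summand (bookkeeping for the ℓ^∞-operator Neumann steps). [folklore] -/
theorem sum_mul_sum_comm {ι κ : Type*} [Fintype ι] [Fintype κ] (T : κ → ℝ) (B : κ → ι → ℝ) (c₀ : ℝ) :
    ∑ y, ∑ z, T z * (c₀ * B z y) = ∑ z, T z * (c₀ * ∑ y, B z y) := by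
  rw [Finset.sum_comm]
  exact Finset.sum_congr rfl fun z _ => by rw [Finset.mul_sum, Finset.mul_sum]

/-- Exchange of a double sum with an affine factorised summand. [folklore] -/
theorem sum_sum_affine_comm {ι κ : Type*} [Fintype ι] [Fintype κ] (T₁ T₂ : κ → ℝ) (B D : κ → ι → ℝ) (c₁ c₂ c₃ : ℝ) :
    ∑ y, ∑ u, (T₁ u * (c₁ * B u y) + T₂ u * (c₂ * B u y + c₃ * D u y))
      = ∑ u, (T₁ u * (c₁ * ∑ y, B u y) + T₂ u * (c₂ * ∑ y, B u y + c₃ * ∑ y, D u y)) := by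
  rw [Finset.sum_comm]
  refine Finset.sum_congr rfl fun u _ => ?_
  simp only [Finset.mul_sum, mul_add, Finset.sum_add_distrib]

/-- **THE WEIGHTED RIEMANN MASS OF THE DRESSED PROPAGATOR**: if `Σ_y N^{−(d+1)}|G(x, y)|e^{δ′|B x − B y|} ≤ C_W` at every `x` (part 11a; `δ′ = 0` is
part 10a's plain mass), `|w| ≤ w₀` and `C_W·w₀ ≤ 1∕2`, then `Σ_y N^{−(d+1)}|G_w(x, y)|e^{δ′|B x − B y|} ≤ 2C_W` at every `x` — ℓ^∞-operator Neumann on the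
fixed point of §1, the weight split through the middle block (`e^{δ|Bx − By|} ≤ e^{δ|Bx − Bz|}e^{δ|Bz − By|}`). [cite: King1986, (2.13) p.653; Balaban1985BackgroundPropagators, (3.35) p.396 (slot)] -/
theorem dressedProp_riemannMassW_le {c : ℝ} {w : Tor (fine Nf U) → ℝ} (hA : IsUnit (fineOp Nf U a c m2)) (hB : IsUnit (fineOpPot Nf U a c m2 w))
    {CW w₀ δ' : ℝ} (hCW : 0 ≤ CW) (hδ' : 0 ≤ δ')
    (hmassW : ∀ x : Tor (fine Nf U), (((Nf : ℕ) : ℝ) ^ (d + 1))⁻¹ *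
      ∑ y, |constrainedProp Nf U a c m2 x y| * Real.exp (δ' * tdistT U (blockOf Nf U x) (blockOf Nf U y)) ≤ CW)
    (hw : ∀ y, |w y| ≤ w₀) (hwin : CW * w₀ ≤ 1 / 2) (x : Tor (fine Nf U)) :
    (((Nf : ℕ) : ℝ) ^ (d + 1))⁻¹ * ∑ y, |dressedProp Nf U a m2 c w x y| * Real.exp (δ' * tdistT U (blockOf Nf U x) (blockOf Nf U y))
      ≤ 2 * CW := by
  have hw₀ := nonneg_of_abs_le hw
  have hNpos : (0 : ℝ) < ((Nf : ℕ) : ℝ) ^ (d + 1) := pow_pos (Nat.cast_pos.mpr (Nat.pos_of_ne_zero (NeZero.ne Nf))) _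
  have hν0 : 0 ≤ (((Nf : ℕ) : ℝ) ^ (d + 1))⁻¹ := inv_nonneg.mpr hNpos.le
  -- abbreviations: `G`, `Gw`, the weights `E x y`
  set G := constrainedProp Nf U a c m2 with hGdef
  set Gw := dressedProp Nf U a m2 c w with hGwdef
  set E : Tor (fine Nf U) → Tor (fine Nf U) → ℝ := fun x' y => Real.exp (δ' * tdistT U (blockOf Nf U x') (blockOf Nf U y)) with hEdef
  have hE0 : ∀ x' y, 0 < E x' y := fun _ _ => Real.exp_pos _
  have hEsplit : ∀ x' z y, E x' y ≤ E x' z * E z y := fun x' z y => exp_weight_split hδ' _ _ _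
  -- the weighted row sums
  set f : Tor (fine Nf U) → ℝ := fun x' => (((Nf : ℕ) : ℝ) ^ (d + 1))⁻¹ * ∑ y, |Gw x' y| * E x' y with hfdef
  refine sup_bound_of_affine f hCW hwin (fun S hS x₀ => ?_) x
  have hS0 : 0 ≤ S := le_trans (by rw [hfdef]; positivity) (hS x₀)
  -- entrywise bound through the fixed point
  have hentry : ∀ y, |Gw x₀ y| * E x₀ y
      ≤ |G x₀ y| * E x₀ y + (((Nf : ℕ) : ℝ) ^ (d + 1))⁻¹ * ∑ z, (|G x₀ z| * E x₀ z) * (w₀ * (|Gw z y| * E z y)) := by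
    intro y
    have hfix : Gw x₀ y = G x₀ y - (((Nf : ℕ) : ℝ) ^ (d + 1))⁻¹ * ∑ z, G x₀ z * w z * Gw z y := dressedProp_fixedPoint hA hB x₀ y
    rw [hfix]
    calc |G x₀ y - (((Nf : ℕ) : ℝ) ^ (d + 1))⁻¹ * ∑ z, G x₀ z * w z * Gw z y| * E x₀ y
        ≤ (|G x₀ y| + (((Nf : ℕ) : ℝ) ^ (d + 1))⁻¹ * ∑ z, |G x₀ z * w z * Gw z y|) * E x₀ y := by
          refine mul_le_mul_of_nonneg_right ((abs_sub _ _).trans (add_le_add le_rfl ?_)) (hE0 _ _).le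
          rw [abs_mul, abs_of_nonneg hν0]
          exact mul_le_mul_of_nonneg_left (abs_sum_le_sum_abs _ _) hν0
      _ = |G x₀ y| * E x₀ y + (((Nf : ℕ) : ℝ) ^ (d + 1))⁻¹ * ∑ z, |G x₀ z * w z * Gw z y| * E x₀ y := by
          rw [add_mul, mul_assoc, sum_mul]
      _ ≤ |G x₀ y| * E x₀ y + (((Nf : ℕ) : ℝ) ^ (d + 1))⁻¹ * ∑ z, (|G x₀ z| * E x₀ z) * (w₀ * (|Gw z y| * E z y)) := by
          refine add_le_add le_rfl (mul_le_mul_of_nonneg_left (sum_le_sum fun z _ => ?_) hν0)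
          rw [abs_mul, abs_mul]
          calc |G x₀ z| * |w z| * |Gw z y| * E x₀ y ≤ |G x₀ z| * w₀ * |Gw z y| * (E x₀ z * E z y) :=
                mul_le_mul (mul_le_mul_of_nonneg_right (mul_le_mul_of_nonneg_left (hw z) (abs_nonneg _)) (abs_nonneg _))
                  (hEsplit x₀ z y) (hE0 _ _).le (by positivity)
            _ = _ := by ring
  -- sum over `y`, exchange, use `f z ≤ S` inside
  have hswap := sum_mul_sum_comm (ι := Tor (fine Nf U)) (κ := Tor (fine Nf U)) (fun z => |G x₀ z| * E x₀ z)
    (fun z y => |Gw z y| * E z y) w₀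
  have hfz : ∀ z, (((Nf : ℕ) : ℝ) ^ (d + 1))⁻¹ * ∑ y, |Gw z y| * E z y = f z := fun z => rfl
  show f x₀ ≤ CW + CW * w₀ * S
  calc f x₀ = (((Nf : ℕ) : ℝ) ^ (d + 1))⁻¹ * ∑ y, |Gw x₀ y| * E x₀ y := rfl
    _ ≤ (((Nf : ℕ) : ℝ) ^ (d + 1))⁻¹ * ∑ y, (|G x₀ y| * E x₀ y
          + (((Nf : ℕ) : ℝ) ^ (d + 1))⁻¹ * ∑ z, (|G x₀ z| * E x₀ z) * (w₀ * (|Gw z y| * E z y))) :=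
        mul_le_mul_of_nonneg_left (sum_le_sum fun y _ => hentry y) hν0
    _ = (((Nf : ℕ) : ℝ) ^ (d + 1))⁻¹ * ∑ y, |G x₀ y| * E x₀ y
          + (((Nf : ℕ) : ℝ) ^ (d + 1))⁻¹ * ∑ z, (|G x₀ z| * E x₀ z) * (w₀ * f z) := by
        have key : (((Nf : ℕ) : ℝ) ^ (d + 1))⁻¹ * ∑ y, (((Nf : ℕ) : ℝ) ^ (d + 1))⁻¹ * ∑ z, (|G x₀ z| * E x₀ z) * (w₀ * (|Gw z y| * E z y))
            = (((Nf : ℕ) : ℝ) ^ (d + 1))⁻¹ * ∑ z, (|G x₀ z| * E x₀ z) * (w₀ * f z) := by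
          rw [← mul_sum, hswap, mul_sum]
          refine congrArg _ (sum_congr rfl fun z _ => ?_)
          rw [← hfz z]
          ring
        rw [sum_add_distrib, mul_add, key]
    _ ≤ CW + (((Nf : ℕ) : ℝ) ^ (d + 1))⁻¹ * ∑ z, (|G x₀ z| * E x₀ z) * (w₀ * S) := by
        refine add_le_add (hmassW x₀) (mul_le_mul_of_nonneg_left (sum_le_sum fun z _ => ?_) hν0)
        exact mul_le_mul_of_nonneg_left (mul_le_mul_of_nonneg_left (hS z) hw₀) (by positivity)
    _ = CW + ((((Nf : ℕ) : ℝ) ^ (d + 1))⁻¹ * ∑ z, |G x₀ z| * E x₀ z) * (w₀ * S) := by rw [← sum_mul, mul_assoc]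
    _ ≤ CW + CW * (w₀ * S) := by
        have := mul_le_mul_of_nonneg_right (hmassW x₀) (mul_nonneg hw₀ hS0)
        linarith
    _ = CW + CW * w₀ * S := by ring

/-- **THE RIEMANN MASS OF THE DRESSED PROPAGATOR** (the weight-free case): `Σ_y N^{−(d+1)}|G_w(x, y)| ≤ 2C_M` in the window `C_M·sup|w| ≤ 1∕2`.
[cite: King1986, (2.13) p.653; Balaban1985BackgroundPropagators, (3.35) p.396 (slot)] -/
theorem dressedProp_riemannMass_le {c : ℝ} {w : Tor (fine Nf U) → ℝ} (hA : IsUnit (fineOp Nf U a c m2)) (hB : IsUnit (fineOpPot Nf U a c m2 w))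
    {CM w₀ : ℝ} (hCM : 0 ≤ CM)
    (hmass : ∀ x : Tor (fine Nf U), (((Nf : ℕ) : ℝ) ^ (d + 1))⁻¹ * ∑ y, |constrainedProp Nf U a c m2 x y| ≤ CM)
    (hw : ∀ y, |w y| ≤ w₀) (hwin : CM * w₀ ≤ 1 / 2) (x : Tor (fine Nf U)) :
    (((Nf : ℕ) : ℝ) ^ (d + 1))⁻¹ * ∑ y, |dressedProp Nf U a m2 c w x y| ≤ 2 * CM := by
  have hmassW : ∀ x : Tor (fine Nf U), (((Nf : ℕ) : ℝ) ^ (d + 1))⁻¹ *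
      ∑ y, |constrainedProp Nf U a c m2 x y| * Real.exp (0 * tdistT U (blockOf Nf U x) (blockOf Nf U y)) ≤ CM := fun x' => by
    simpa only [zero_mul, Real.exp_zero, mul_one] using hmass x'
  have h := dressedProp_riemannMassW_le hA hB hCM le_rfl hmassW hw hwin x
  simpa only [zero_mul, Real.exp_zero, mul_one] using h

end Mass

/-! ## §3 The Riemann-sum two-spacing rate of the dressed propagator -/

section Rate

variable (L : ℕ) [NeZero L] {U : Fin (d + 1) → ℕ} [∀ μ, NeZero (U μ)] {a m2 : ℝ}

/-- **THE RIEMANN-SUM TWO-SPACING RATE OF THE DRESSED PROPAGATOR** (the scalar model's nonperturbative (3.36)-type letter for `G_{k,w}`).  Two runs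
`L^k`, `L·L^k` over `U` with King's coefficients (`a_k, a_{k+1}`, `c = N²`) and potentials `w, w′`: numerical letters `C_M ≥` the undressed Riemann masses
(both runs), `R ≥` the undressed Riemann-sum two-spacing rate (part 10a), `|w|, |w′| ≤ w₀`, coherence `|w′(z′) − w(z)| ≤ ν` (`z` under `z′`), window
`C_M·w₀ ≤ 1∕2`.  Then at every fine `x′`:
`Σ_{y′} N′^{−(d+1)}|G′_{w′}(x′, y′) − G_w(x, y)| ≤ 2(R + R·w₀·(2C_M) + C_M·ν·(2C_M))` (`x, y` under `x′, y′`): subtract the two fixed points, move the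
coarse middle sum to the finer lattice (`avg_comp_underPtN`), telescope, sum over BOTH free indices with the Riemann weight, close by the ℓ^∞ step.
[cite: King1986, (2.13) p.653, Prop. 3.8 (3.71) p.664, p.664 (pairing); Balaban1985BackgroundPropagators, (3.36) p.396 (slot)] -/
theorem dressedProp_riemannRate_le {k : ℕ} (hak : 0 ≤ aK a L k) (hak' : 0 ≤ aK a L (k + 1)) (hm : 0 < m2)
    {w : Tor (fine (L ^ k) U) → ℝ} {w' : Tor (fine (L ^ 1 * L ^ k) U) → ℝ}
    (hB : IsUnit (fineOpPot (L ^ k) U (aK a L k) (((L ^ k : ℕ) : ℝ) ^ 2) m2 w))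
    (hB' : IsUnit (fineOpPot (L ^ 1 * L ^ k) U (aK a L (k + 1)) (((L ^ 1 * L ^ k : ℕ) : ℝ) ^ 2) m2 w'))
    {CM R w₀ ν : ℝ} (hCM : 0 ≤ CM) (hR : 0 ≤ R)
    (hmass : ∀ x : Tor (fine (L ^ k) U),
      (((L ^ k : ℕ) : ℝ) ^ (d + 1))⁻¹ * ∑ y, |constrainedProp (L ^ k) U (aK a L k) (((L ^ k : ℕ) : ℝ) ^ 2) m2 x y| ≤ CM)
    (hmass' : ∀ x' : Tor (fine (L ^ 1 * L ^ k) U),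
      (((L ^ 1 * L ^ k : ℕ) : ℝ) ^ (d + 1))⁻¹ *
        ∑ y', |constrainedProp (L ^ 1 * L ^ k) U (aK a L (k + 1)) (((L ^ 1 * L ^ k : ℕ) : ℝ) ^ 2) m2 x' y'| ≤ CM)
    (hrate : ∀ x' : Tor (fine (L ^ 1 * L ^ k) U),
      (((L ^ 1 * L ^ k : ℕ) : ℝ) ^ (d + 1))⁻¹ *
          ∑ y', |constrainedProp (L ^ 1 * L ^ k) U (aK a L (k + 1)) (((L ^ 1 * L ^ k : ℕ) : ℝ) ^ 2) m2 x' y'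
            - constrainedProp (L ^ k) U (aK a L k) (((L ^ k : ℕ) : ℝ) ^ 2) m2 (underPtN L k 1 U x') (underPtN L k 1 U y')| ≤ R)
    (hw : ∀ y, |w y| ≤ w₀) (hw' : ∀ y', |w' y'| ≤ w₀) (hcoh : ∀ y', |w' y' - w (underPtN L k 1 U y')| ≤ ν)
    (hwin : CM * w₀ ≤ 1 / 2) (x' : Tor (fine (L ^ 1 * L ^ k) U)) :
    (((L ^ 1 * L ^ k : ℕ) : ℝ) ^ (d + 1))⁻¹ *
        ∑ y', |dressedProp (L ^ 1 * L ^ k) U (aK a L (k + 1)) m2 (((L ^ 1 * L ^ k : ℕ) : ℝ) ^ 2) w' x' y'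
          - dressedProp (L ^ k) U (aK a L k) m2 (((L ^ k : ℕ) : ℝ) ^ 2) w (underPtN L k 1 U x') (underPtN L k 1 U y')|
      ≤ 2 * (R + R * (w₀ * (2 * CM)) + CM * (ν * (2 * CM))) := by
  have hw₀ : 0 ≤ w₀ := nonneg_of_abs_le hw
  have hν : 0 ≤ ν := (abs_nonneg _).trans (hcoh fun _ => 0)
  have hA : IsUnit (fineOp (L ^ k) U (aK a L k) (((L ^ k : ℕ) : ℝ) ^ 2) m2) := fineOp_isUnit _ U hak (by positivity) hm
  have hA' : IsUnit (fineOp (L ^ 1 * L ^ k) U (aK a L (k + 1)) (((L ^ 1 * L ^ k : ℕ) : ℝ) ^ 2) m2) := fineOp_isUnit _ U hak' (by positivity) hm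
  have hN'pos : (0 : ℝ) < (((L ^ 1 * L ^ k : ℕ) : ℝ)) ^ (d + 1) := pow_pos (Nat.cast_pos.mpr (Nat.pos_of_ne_zero (NeZero.ne _))) _
  set μ : ℝ := ((((L ^ 1 * L ^ k : ℕ) : ℝ)) ^ (d + 1))⁻¹ with hμdef
  have hμ0 : 0 ≤ μ := inv_nonneg.mpr hN'pos.le
  set G := constrainedProp (L ^ k) U (aK a L k) (((L ^ k : ℕ) : ℝ) ^ 2) m2 with hGdef
  set G' := constrainedProp (L ^ 1 * L ^ k) U (aK a L (k + 1)) (((L ^ 1 * L ^ k : ℕ) : ℝ) ^ 2) m2 with hG'def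
  set Gw := dressedProp (L ^ k) U (aK a L k) m2 (((L ^ k : ℕ) : ℝ) ^ 2) w with hGwdef
  set Gw' := dressedProp (L ^ 1 * L ^ k) U (aK a L (k + 1)) m2 (((L ^ 1 * L ^ k : ℕ) : ℝ) ^ 2) w' with hGw'def
  -- the dressed fine mass `≤ 2C_M` (§2)
  have hMw' : ∀ z', μ * ∑ y', |Gw' z' y'| ≤ 2 * CM := fun z' =>
    dressedProp_riemannMass_le hA' hB' hCM hmass' hw' hwin z'
  -- the row defect and the ℓ^∞ step
  set f : Tor (fine (L ^ 1 * L ^ k) U) → ℝ := fun z' =>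
    μ * ∑ y', |Gw' z' y' - Gw (underPtN L k 1 U z') (underPtN L k 1 U y')| with hfdef
  refine sup_bound_of_affine f (by positivity) hwin (fun S hS z' => ?_) x'
  have hS0 : 0 ≤ S := le_trans (by rw [hfdef]; positivity) (hS z')
  set z := underPtN L k 1 U z' with hzdef
  -- entrywise: subtract the two fixed points; the coarse middle sum moved to the finer lattice; telescope
  have hentry : ∀ y', |Gw' z' y' - Gw z (underPtN L k 1 U y')|
      ≤ |G' z' y' - G z (underPtN L k 1 U y')|
        + μ * ∑ u', (|G' z' u' - G z (underPtN L k 1 U u')| * (w₀ * |Gw' u' y'|)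
          + |G z (underPtN L k 1 U u')| * (ν * |Gw' u' y'| + w₀ * |Gw' u' y' - Gw (underPtN L k 1 U u') (underPtN L k 1 U y')|)) := by
    intro y'
    have hfine : Gw' z' y' = G' z' y' - μ * ∑ u', G' z' u' * w' u' * Gw' u' y' := dressedProp_fixedPoint hA' hB' z' y'
    have hcoarse : Gw z (underPtN L k 1 U y') = G z (underPtN L k 1 U y')
        - (((L ^ k : ℕ) : ℝ) ^ (d + 1))⁻¹ * ∑ u, G z u * w u * Gw u (underPtN L k 1 U y') := dressedProp_fixedPoint hA hB z _
    have hmove : (((L ^ k : ℕ) : ℝ) ^ (d + 1))⁻¹ * ∑ u, G z u * w u * Gw u (underPtN L k 1 U y')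
        = μ * ∑ u', G z (underPtN L k 1 U u') * w (underPtN L k 1 U u') * Gw (underPtN L k 1 U u') (underPtN L k 1 U y') :=
      (avg_comp_underPtN L U k (fun u => G z u * w u * Gw u (underPtN L k 1 U y'))).symm
    have hdiff : Gw' z' y' - Gw z (underPtN L k 1 U y') = (G' z' y' - G z (underPtN L k 1 U y'))
        - μ * ∑ u', (G' z' u' * w' u' * Gw' u' y'
          - G z (underPtN L k 1 U u') * w (underPtN L k 1 U u') * Gw (underPtN L k 1 U u') (underPtN L k 1 U y')) := by
      rw [hfine, hcoarse, hmove, sum_sub_distrib, mul_sub]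
      ring
    rw [hdiff]
    refine (abs_sub _ _).trans (add_le_add le_rfl ?_)
    rw [abs_mul, abs_of_nonneg hμ0]
    refine mul_le_mul_of_nonneg_left ((abs_sum_le_sum_abs _ _).trans (sum_le_sum fun u' _ => ?_)) hμ0
    refine (abs_kernel3_sub_le _ _ _ _ _ _).trans (add_le_add ?_ ?_)
    · rw [mul_assoc]
      exact mul_le_mul_of_nonneg_left (mul_le_mul_of_nonneg_right (hw' u') (abs_nonneg _)) (abs_nonneg _)
    · exact mul_le_mul_of_nonneg_left (add_le_add (mul_le_mul_of_nonneg_right (hcoh u') (abs_nonneg _))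
        (mul_le_mul_of_nonneg_right (hw _) (abs_nonneg _))) (abs_nonneg _)
  -- sum over `y′`, exchange the two sums, use the dressed mass and `f ≤ S` inside
  have hswap := sum_sum_affine_comm (ι := Tor (fine (L ^ 1 * L ^ k) U)) (κ := Tor (fine (L ^ 1 * L ^ k) U))
    (fun u' => |G' z' u' - G z (underPtN L k 1 U u')|) (fun u' => |G z (underPtN L k 1 U u')|)
    (fun u' y' => |Gw' u' y'|) (fun u' y' => |Gw' u' y' - Gw (underPtN L k 1 U u') (underPtN L k 1 U y')|) w₀ ν w₀
  have hfu : ∀ u', μ * ∑ y', |Gw' u' y' - Gw (underPtN L k 1 U u') (underPtN L k 1 U y')| = f u' := fun u' => rfl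
  have hmoveAbs : μ * ∑ u', |G z (underPtN L k 1 U u')| = (((L ^ k : ℕ) : ℝ) ^ (d + 1))⁻¹ * ∑ u, |G z u| :=
    avg_comp_underPtN L U k (fun u => |G z u|)
  show f z' ≤ R + R * (w₀ * (2 * CM)) + CM * (ν * (2 * CM)) + CM * w₀ * S
  calc f z' = μ * ∑ y', |Gw' z' y' - Gw z (underPtN L k 1 U y')| := rfl
    _ ≤ μ * ∑ y', (|G' z' y' - G z (underPtN L k 1 U y')|
          + μ * ∑ u', (|G' z' u' - G z (underPtN L k 1 U u')| * (w₀ * |Gw' u' y'|)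
            + |G z (underPtN L k 1 U u')| * (ν * |Gw' u' y'| + w₀ * |Gw' u' y' - Gw (underPtN L k 1 U u') (underPtN L k 1 U y')|))) :=
        mul_le_mul_of_nonneg_left (sum_le_sum fun y' _ => hentry y') hμ0
    _ = μ * ∑ y', |G' z' y' - G z (underPtN L k 1 U y')|
        + μ * ∑ u', (|G' z' u' - G z (underPtN L k 1 U u')| * (w₀ * (μ * ∑ y', |Gw' u' y'|))
          + |G z (underPtN L k 1 U u')| * (ν * (μ * ∑ y', |Gw' u' y'|) + w₀ * f u')) := by
        have key : μ * ∑ y', μ * ∑ u', (|G' z' u' - G z (underPtN L k 1 U u')| * (w₀ * |Gw' u' y'|)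
              + |G z (underPtN L k 1 U u')| * (ν * |Gw' u' y'| + w₀ * |Gw' u' y' - Gw (underPtN L k 1 U u') (underPtN L k 1 U y')|))
            = μ * ∑ u', (|G' z' u' - G z (underPtN L k 1 U u')| * (w₀ * (μ * ∑ y', |Gw' u' y'|))
              + |G z (underPtN L k 1 U u')| * (ν * (μ * ∑ y', |Gw' u' y'|) + w₀ * f u')) := by
          rw [← mul_sum, hswap, mul_sum]
          refine congrArg _ (sum_congr rfl fun u' _ => ?_)
          rw [← hfu u']
          ring
        rw [sum_add_distrib, mul_add, key]
    _ ≤ R + μ * ∑ u', (|G' z' u' - G z (underPtN L k 1 U u')| * (w₀ * (2 * CM))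
          + |G z (underPtN L k 1 U u')| * (ν * (2 * CM) + w₀ * S)) := by
        refine add_le_add (hrate z') (mul_le_mul_of_nonneg_left (sum_le_sum fun u' _ => add_le_add ?_ ?_) hμ0)
        · exact mul_le_mul_of_nonneg_left (mul_le_mul_of_nonneg_left (hMw' u') hw₀) (abs_nonneg _)
        · exact mul_le_mul_of_nonneg_left (add_le_add (mul_le_mul_of_nonneg_left (hMw' u') hν)
            (mul_le_mul_of_nonneg_left (hS u') hw₀)) (abs_nonneg _)
    _ = R + (μ * ∑ u', |G' z' u' - G z (underPtN L k 1 U u')|) * (w₀ * (2 * CM))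
          + (μ * ∑ u', |G z (underPtN L k 1 U u')|) * (ν * (2 * CM) + w₀ * S) := by
        rw [sum_add_distrib, mul_add, ← sum_mul, ← sum_mul]
        ring
    _ ≤ R + R * (w₀ * (2 * CM)) + CM * (ν * (2 * CM) + w₀ * S) := by
        have h1 := hrate z'
        have h2 : μ * ∑ u', |G z (underPtN L k 1 U u')| ≤ CM := by rw [hmoveAbs]; exact hmass z
        have h3 := mul_le_mul_of_nonneg_right h1 (by positivity : 0 ≤ w₀ * (2 * CM))
        have h4 := mul_le_mul_of_nonneg_right h2 (by positivity : 0 ≤ ν * (2 * CM) + w₀ * S)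
        linarith
    _ = R + R * (w₀ * (2 * CM)) + CM * (ν * (2 * CM)) + CM * w₀ * S := by ring

end Rate

end Summit.QuantumFields.YangMills.BalabanUVNodes.N15.KingModel

end
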